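import Summits.ResolutionOfSingularities.ResolutionOfSingularities.Theorems.EquisingularLiftEquisingularLiftNatCentreCodimTwo
import Summits.ResolutionOfSingularities.ResolutionOfSingularities.Theorems.EquisingularLiftEquisingularLiftNatStalkDimension
import Summits.ResolutionOfSingularities.ResolutionOfSingularities.Theorems.EquisingularLiftEquisingularLiftNatTowerRationalDefs
import Summits.ResolutionOfSingularities.ResolutionOfSingularities.Theorems.EquisingularLiftEquisingularLiftChainRegular
import HarnessLib

/-!
# [OURS · L1 W4.5(b) · EL♮(3)] SUPPLYING THE 2-FRAME STAND-IN `hFrame` OF THE TOWER₄ ASSEMBLY AT EVERY STAGE: the fibre datum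
# «`dim 𝒪_{Z̃,z} = 1` at closed points» — read off at the curve step from the codimension clause, moved along sections, fed to T-DIM-CENTRE

Crux chain w45b (cell `res-hironaka`, slot W4.5(b)), working crux **EL♮** = stmt-ResolutionOfSingularities-20038, child **EL♮(3)** =
stmt-ResolutionOfSingularities-20148, route EquisingularLift, line `sections`; registered stub `stub_elnat_coneTowerPointResolution` (CHILD v21
997d0099a8b9ec2a, `₄`). Written by res-L1-w45b-stub-4 g8 (TOWER₃/₄ assembly inputs; sequel of …NatTowerRootsDischarge, whose bricks
`Tower.inv₂_coneRound_new_sec` / `Tower.inv₂_of_invKC_curveStep_sec` / `…_forget_sec` carry the stand-in `hFrame`). HONEST FRAMING: OURS; NOT a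
statement of any manuscript; AI-written, weaker than expert review. No `sorry`; standard axioms; DEF-FREE. `--supports stmt-ResolutionOfSingularities-20148 --as helper`.

WHAT. The stand-in (c) `hFrame` «quasi-regular 2-frames of every regular `O`-flat centre `𝒞` with exact reduced trace `𝓘⟨Z⟩` on a `Ch`-stage with
model square `jG`» is res-L1-w45b-stub-3's T-DIM-CENTRE `forall_exists_twoFrame_of_model_of_isProper` (…NatCentreCodimTwo p568469) fed with
T-DIM (`ringKrullDim_stalk_eq_succ_of_chain`, …NatStalkDimension: `dim 𝒪_{X,x} = 3 + 1` at closed special points of a chain stage over a smooth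
`P/O` of relative dimension 3) and ONE fibre datum: `hZdim : ∀ z : Z̃, IsClosed {z} → dim 𝒪_{Z̃,z} = 1`. This file:
* `hFrame_of_ringKrullDim_redSub` — the stand-in VERBATIM (the ∀-shape of …NatTowerRootsDischarge) at a stage `(G, T, Z)` from `hZdim` for `Z̃`;
* `ringKrullDim_redSub_stalk_eq_of_dirStepSec` — `hZdim` moves along a SECTION (`DirStepSec`: `Z̃ ≅ Z̃₉`), so at every round of `TowerRound₃` it
  comes from the carrier's `hZdim₉` (a CONTEXT fact of the tower: `Z₉` is fixed);
* `ringKrullDim_fibre_stalk_eq_of_codim` — `hZdim₉` itself is READ OFF at the curve step from the codimension clause (v) of `TCPlus.MemberKC`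
  («`dim (𝒪_{X,x} ⧸ 𝒞_x) + 2 = dim 𝒪_{X,x}` at closed special points of the in-carrier centre `𝓢 ⊔ K`, whose reduced trace IS `Z̃₉`) by the flat
  dimension formula `dim (𝒪_{X,jz} ⧸ 𝒞) = dim 𝒪_{Z̃₉,z} + 1` (stub-3's `ringKrullDim_quotient_stalkIdeal_eq_of_model`) and T-DIM — so res-D-pv-029's
  `INV₁` can carry `hZdim₉` next to `Z₉.Infinite` at no cost, and NO «infinite fibre» input is ever needed (an infinite `Z` with an isolated point
  would break codimension 2; `hZdim` is the honest currency).

References (index only): res-L1-w45b-stub-3 …NatCentreCodimTwo p568469 / …Adapters p570070, …NatCentreTwoFrame p564791; T-DIM …NatStalkDimension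
p513633; res-D-pv-029 …NatSubchainSupplierInvKDefs (`MemberKC` (v)), assembly mirror `D/res-D-pv-029/gen8/TowerAssembly.lean` v5; res-L1-w45b-stub-4
…NatTowerRootsDischarge p570221.
-/

set_option linter.dupNamespace false -- mandated namespace `Summit.<Summit>.<Problem>` of this single-conjunct summit
set_option linter.overlappingInstances false -- signatures carry `[IsDomain O] [IsDiscreteValuationRing O]`

noncomputable section

open CategoryTheory CategoryTheory.Limits AlgebraicGeometry TopologicalSpace Topology IsLocalRing
open Literature.AlgebraicGeometry.Resolution
open AlgebraicGeometry.Scheme.IdealSheafData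
open Summit.ResolutionOfSingularities.ResolutionOfSingularities.Theses.EquisingularLift.Split
open Summit.ResolutionOfSingularities.ResolutionOfSingularities.Cruxes.EquisingularLift.StrataSplit

namespace Summit.ResolutionOfSingularities.ResolutionOfSingularities.Cruxes.EquisingularLiftNat.Sections

/-! ## Moving the fibre datum along an isomorphism / a section -/

/-- Local dimensions at closed points are invariant under an isomorphism of schemes (given as a morphism with `IsIso`).
[OURS · elementary] -/
theorem ringKrullDim_stalk_eq_of_isIso {C C' : Scheme.{0}} (δ : C ⟶ C') [IsIso δ] {d : WithBot ℕ∞}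
    (h : ∀ c' : C', IsClosed ({c'} : Set C') → ringKrullDim (C'.presheaf.stalk c') = d)
    (c : C) (hc : IsClosed ({c} : Set C)) : ringKrullDim (C.presheaf.stalk c) = d := by
  have hc' : IsClosed ({δ c} : Set C') := by
    have h1 := (Scheme.homeoOfIso (asIso δ)).isClosedMap _ hc
    rwa [Set.image_singleton] at h1
  rw [← h (δ c) hc']
  exact ringKrullDim_eq_of_ringEquiv (asIso (δ.stalkMap c)).commRingCatIsoToRingEquiv.symm

/-- **The fibre datum moves along a section**: under `DirStepSec F₉ F₁₀ υ' Z₉ hZ₉ G γ Z hZ` (`Z̃ ≅ Z̃₉`), `dim 𝒪_{Z̃₉,·} = d` at closed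
points implies `dim 𝒪_{Z̃,·} = d` at closed points — the `hZdim` input of `hFrame_of_ringKrullDim_redSub` at every round of `TowerRound₃`.
[OURS · elementary] toward `stub_elnat_coneTowerPointResolution` (stmt-ResolutionOfSingularities-20148); NOT a statement of the manuscript. -/
theorem ringKrullDim_redSub_stalk_eq_of_dirStepSec {F₉ F₁₀ : Scheme.{0}} {υ' : F₁₀ ⟶ F₉} {Z₉ : Set F₉} {hZ₉ : IsClosed Z₉}
    {G : Scheme.{0}} {γ : G ⟶ F₁₀} {Z : Set G} {hZ : IsClosed Z} (hsec : DirStepSec F₉ F₁₀ υ' Z₉ hZ₉ G γ Z hZ) {d : WithBot ℕ∞}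
    (h₉ : ∀ z₉ : ↥(redSub F₉ Z₉ hZ₉), IsClosed ({z₉} : Set ↥(redSub F₉ Z₉ hZ₉)) → ringKrullDim ((redSub F₉ Z₉ hZ₉).presheaf.stalk z₉) = d) :
    ∀ z : ↥(redSub G Z hZ), IsClosed ({z} : Set ↥(redSub G Z hZ)) → ringKrullDim ((redSub G Z hZ).presheaf.stalk z) = d := by
  obtain ⟨δ, -, hiso⟩ := hsec
  exact ringKrullDim_stalk_eq_of_isIso δ h₉

/-! ## Reading the fibre datum off the codimension clause (curve step) -/

/-- Cancellation in `WithBot ℕ∞`: `a + 1 + 2 = d + 2 + 1 ⇒ a = d` for natural `d`. [elementary] -/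
theorem withBot_enat_cancel_three {a : WithBot ℕ∞} {d : ℕ} (h : a + 1 + 2 = ((d + 2 + 1 : ℕ) : WithBot ℕ∞)) :
    a = (d : WithBot ℕ∞) := by
  induction a using WithBot.recBotCoe with
  | bot =>
    exfalso
    rw [WithBot.bot_add, WithBot.bot_add, ← WithBot.coe_natCast] at h
    exact WithBot.bot_ne_coe h
  | coe b =>
    have h2 : ((b : WithBot ℕ∞) + 1 + 2) = ((b + 1 + 2 : ℕ∞) : WithBot ℕ∞) := by push_cast; rfl
    rw [h2, ← WithBot.coe_natCast, WithBot.coe_inj] at h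
    rw [← WithBot.coe_natCast]
    congr 1
    induction b using ENat.recTopCoe with
    | top =>
      exfalso
      rw [top_add, top_add] at h
      exact (ENat.top_ne_coe _ h).elim
    | coe m =>
      have h' : ((m + 1 + 2 : ℕ) : ℕ∞) = ((d + 2 + 1 : ℕ) : ℕ∞) := by
        push_cast at h ⊢; exact h
      have := Nat.cast_injective (R := ℕ∞) h'
      have hm : m = d := by omega
      subst hm; rfl

/-- **`hZdim₉` READ OFF AT THE CURVE STEP.** Model square `(j, t; r, Spec θ)` over a DVR, a centre `𝒞` FLAT over `O` with special fibre
`V(𝒟)`, `𝒟 = 𝒞·𝒪_F` (in the tower: `𝒞 = 𝓢 ⊔ K`, `𝒟 = 𝓘⟨Z₉⟩`, `V(𝒟) = Z̃₉`). If at the closed special points `x ∈ supp 𝒞` one has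
`dim 𝒪_{X,x} = n + 1` (T-DIM) and `dim (𝒪_{X,x} ⧸ 𝒞_x) + 2 = dim 𝒪_{X,x}` (clause (v) of `TCPlus.MemberKC`), with `n = d + 2`, then
`dim 𝒪_{V(𝒟),z} = d` at every closed point `z` of `V(𝒟)` — by stub-3's flat dimension formula `dim (𝒪_{X,jz} ⧸ 𝒞) = dim 𝒪_{V(𝒟),z} + 1`.
[cite: Matsumura1987, Thm. 15.1] [OURS · L1 W4.5b · arithmetic over …NatCentreCodimTwo] toward `stub_elnat_coneTowerPointResolution`
(stmt-ResolutionOfSingularities-20148); NOT a statement of the manuscript. -/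
theorem ringKrullDim_fibre_stalk_eq_of_codim (O : Type) [CommRing O] [IsDomain O] [IsDiscreteValuationRing O]
    (k : Type) [Field k] (θ : O →+* k) (hθ : Function.Surjective θ) {X F : Scheme.{0}} (r : X ⟶ Spec (.of O))
    (j : F ⟶ X) (t : F ⟶ Spec (.of k)) (hsq : IsPullback j t r (Spec.map (CommRingCat.ofHom θ)))
    [IsLocallyNoetherian X] (𝒞 : X.IdealSheafData) [Flat (𝒞.subschemeι ≫ r)] {𝒟 : F.IdealSheafData}
    (hCD : 𝒞.comap j = 𝒟) {n d : ℕ} (hnd : n = d + 2)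
    (hdimX : ∀ x ∈ 𝒞.support, IsClosed ({x} : Set X) → r x = closedPoint O →
      ringKrullDim (X.presheaf.stalk x) = ((n + 1 : ℕ) : WithBot ℕ∞))
    (hv : ∀ x ∈ 𝒞.support, r x = closedPoint O → IsClosed ({x} : Set X) →
      ringKrullDim (X.presheaf.stalk x ⧸ stalkIdeal 𝒞 x) + 2 = ringKrullDim (X.presheaf.stalk x)) :
    ∀ z : ↥𝒟.subscheme, IsClosed ({z} : Set ↥𝒟.subscheme) → ringKrullDim (𝒟.subscheme.presheaf.stalk z) = (d : WithBot ℕ∞) := by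
  intro z hz
  haveI : IsClosedImmersion (Spec.map (CommRingCat.ofHom θ)) := IsClosedImmersion.spec_of_surjective _ hθ
  haveI : IsClosedImmersion j := MorphismProperty.IsStableUnderBaseChange.of_isPullback hsq.flip inferInstance
  -- the point `x = j (ι z)`: closed, special, in the support
  have hxcl : IsClosed ({j (𝒟.subschemeι z)} : Set X) := by
    have h1 := (j.isClosedEmbedding.isClosedMap) _ ((𝒟.subschemeι.isClosedEmbedding.isClosedMap) _ hz)
    rwa [Set.image_singleton, Set.image_singleton] at h1
  have hxsp : r (j (𝒟.subschemeι z)) = closedPoint O := by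
    have h1 : j (𝒟.subschemeι z) ∈ Set.range j := ⟨_, rfl⟩
    rw [range_eq_preimage_of_isPullback hsq, range_specMap_of_surjective_of_field θ hθ] at h1
    exact h1
  have hxsupp : j (𝒟.subschemeι z) ∈ (𝒞.support : Set X) := by
    have h1 : 𝒟.subschemeι z ∈ ((𝒞.comap j).support : Set F) := by
      rw [hCD, ← Scheme.IdealSheafData.range_subschemeι]; exact ⟨z, rfl⟩
    rw [Scheme.IdealSheafData.support_comap] at h1
    exact h1
  have hq := ringKrullDim_quotient_stalkIdeal_eq_of_model O k θ hθ r j t hsq 𝒞 hCD z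
  have h1 := hv _ hxsupp hxsp hxcl
  rw [hq, hdimX _ hxsupp hxcl hxsp, hnd] at h1
  exact withBot_enat_cancel_three h1

/-! ## The stand-in `hFrame` at a stage, from the fibre datum -/

/-- **THE 2-FRAME STAND-IN `hFrame` OF …NatTowerRootsDischarge AT A STAGE `(G, T, Z)`, from `hZdim`** (see the module docstring): on a
`Ch`-stage `(X, σ, S)` over the smooth proper `P/O` of relative dimension `3` with model square `jG : G ⟶ X`, every regular `O`-flat centre
`𝒞` with exact reduced trace `𝒞.comap jG = 𝓘⟨Z⟩` has quasi-regular 2-frames at all points of its support, PROVIDED `dim 𝒪_{Z̃,z} = 1` at the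
closed points of `Z̃ = redSub G Z hZ` — by stub-3's `forall_exists_twoFrame_of_model_of_isProper` with T-DIM for `dim 𝒪_{X,x} = 4`.
[cite: Matsumura1987, Thm. 14.2, Thm. 15.1, Thm. 16.2] [cite: GortzWedhorn2020, Prop. 13.91] [OURS · L1 W4.5b · composition] toward
`stub_elnat_coneTowerPointResolution` (stmt-ResolutionOfSingularities-20148 / -20038); NOT a statement of the manuscript. -/
theorem hFrame_of_ringKrullDim_redSub (O : Type) [CommRing O] [IsDomain O] [IsDiscreteValuationRing O] (k : Type) [Field k]
    (θ : O →+* k) (hθ : Function.Surjective θ)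
    (P : Scheme.{0}) [IsIntegral P] (q : P ⟶ Spec (.of O)) [IsProper q] [SmoothOfRelativeDimension 3 q] (Y : Set P)
    (hYirr : IsIrreducible Y) (hYcl : IsClosed Y) (hPnoeth : IsLocallyNoetherian P) (hPreg : Scheme.IsRegular P)
    (Ch : ∀ X' : Scheme.{0}, (X' ⟶ P) → Set X' → Prop)
    (hChain : ∀ (X' : Scheme.{0}) (σ : X' ⟶ P) (S : Set X'), Ch X' σ S → Chain P Y X' σ S)
    {G : Scheme.{0}} (T Z : Set G) (hZ : IsClosed Z)
    (hZdim : ∀ z : ↥(redSub G Z hZ), IsClosed ({z} : Set ↥(redSub G Z hZ)) →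
      ringKrullDim ((redSub G Z hZ).presheaf.stalk z) = ((1 : ℕ) : WithBot ℕ∞)) :
    ∀ (X : Scheme.{0}) (σ : X ⟶ P) (S : Set X) (jG : G ⟶ X) (tG : G ⟶ Spec (.of k)) (𝒞 : X.IdealSheafData),
      Ch X σ S → IsIntegral X → IsLocallyNoetherian X → Scheme.IsRegular X → IsDominant (σ ≫ q) →
      IsPullback jG tG (σ ≫ q) (Spec.map (CommRingCat.ofHom θ)) → jG '' T = S →
      𝒞.comap jG = vanishingIdeal ⟨Z, hZ⟩ → Flat (𝒞.subschemeι ≫ σ ≫ q) → Scheme.IsRegular 𝒞.subscheme →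
      ∀ x ∈ 𝒞.support, ∃ c : Fin 2 → X.presheaf.stalk x, Ideal.span (Set.range c) = stalkIdeal 𝒞 x ∧ IsQuasiRegular c := by
  intro X σ S jG tG 𝒞 hCh _ hXnoeth hXreg _ hsq _ hCD hCflat hCreg
  haveI := hXnoeth
  haveI : IsProper σ := (chain_isRegular P Y X σ S (hChain _ _ _ hCh) hPnoeth hPreg).2.2
  haveI : IsProper (σ ≫ q) := inferInstance
  haveI : Flat (𝒞.subschemeι ≫ σ ≫ q) := hCflat
  have hξ : IsGenericPoint hYirr.genericPoint Y := hYirr.isGenericPoint_genericPoint hYcl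
  refine forall_exists_twoFrame_of_model_of_isProper O k θ hθ (σ ≫ q) jG tG hsq hXreg 𝒞 hCreg hCD (n := 3) (d := 1) rfl ?_ ?_
  · intro z hzcl hzsp
    exact ringKrullDim_stalk_eq_succ_of_chain q 3 hξ (hChain _ _ _ hCh) hzcl hzsp
  · intro z hz _
    exact hZdim z hz

/-- **The stand-in `hFrame` at a ROUND of `TowerRound₃`** (section `hsec : Z̃ ≅ Z̃₉`), from the carrier's context datum `hZdim₉`.
[OURS · L1 W4.5b · composition] toward `stub_elnat_coneTowerPointResolution` (stmt-ResolutionOfSingularities-20148); NOT a statement of the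
manuscript. -/
theorem hFrame_of_dirStepSec (O : Type) [CommRing O] [IsDomain O] [IsDiscreteValuationRing O] (k : Type) [Field k]
    (θ : O →+* k) (hθ : Function.Surjective θ)
    (P : Scheme.{0}) [IsIntegral P] (q : P ⟶ Spec (.of O)) [IsProper q] [SmoothOfRelativeDimension 3 q] (Y : Set P)
    (hYirr : IsIrreducible Y) (hYcl : IsClosed Y) (hPnoeth : IsLocallyNoetherian P) (hPreg : Scheme.IsRegular P)
    (Ch : ∀ X' : Scheme.{0}, (X' ⟶ P) → Set X' → Prop)
    (hChain : ∀ (X' : Scheme.{0}) (σ : X' ⟶ P) (S : Set X'), Ch X' σ S → Chain P Y X' σ S)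
    {F₉ : Scheme.{0}} {Z₉ : Set F₉} {hZ₉ : IsClosed Z₉} {F₁₀ : Scheme.{0}} {υ' : F₁₀ ⟶ F₉}
    (hZdim₉ : ∀ z₉ : ↥(redSub F₉ Z₉ hZ₉), IsClosed ({z₉} : Set ↥(redSub F₉ Z₉ hZ₉)) →
      ringKrullDim ((redSub F₉ Z₉ hZ₉).presheaf.stalk z₉) = ((1 : ℕ) : WithBot ℕ∞))
    {G : Scheme.{0}} {γ : G ⟶ F₁₀} (T Z : Set G) (hZ : IsClosed Z) (hsec : DirStepSec F₉ F₁₀ υ' Z₉ hZ₉ G γ Z hZ) :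
    ∀ (X : Scheme.{0}) (σ : X ⟶ P) (S : Set X) (jG : G ⟶ X) (tG : G ⟶ Spec (.of k)) (𝒞 : X.IdealSheafData),
      Ch X σ S → IsIntegral X → IsLocallyNoetherian X → Scheme.IsRegular X → IsDominant (σ ≫ q) →
      IsPullback jG tG (σ ≫ q) (Spec.map (CommRingCat.ofHom θ)) → jG '' T = S →
      𝒞.comap jG = vanishingIdeal ⟨Z, hZ⟩ → Flat (𝒞.subschemeι ≫ σ ≫ q) → Scheme.IsRegular 𝒞.subscheme →
      ∀ x ∈ 𝒞.support, ∃ c : Fin 2 → X.presheaf.stalk x, Ideal.span (Set.range c) = stalkIdeal 𝒞 x ∧ IsQuasiRegular c :=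
  hFrame_of_ringKrullDim_redSub O k θ hθ P q Y hYirr hYcl hPnoeth hPreg Ch hChain T Z hZ
    (ringKrullDim_redSub_stalk_eq_of_dirStepSec hsec hZdim₉)

/-- **The stand-in `hFrame` at the CURVE STEP** (`G := F₉`, `Z := Z₉`), from the carrier's context datum `hZdim₉` — or use stub-3's
`forall_exists_twoFrame_of_codim_over_closedPoint` with `MemberKC` (v) directly. [OURS · L1 W4.5b · composition]; NOT a statement of the manuscript. -/
theorem hFrame_curveStep (O : Type) [CommRing O] [IsDomain O] [IsDiscreteValuationRing O] (k : Type) [Field k]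
    (θ : O →+* k) (hθ : Function.Surjective θ)
    (P : Scheme.{0}) [IsIntegral P] (q : P ⟶ Spec (.of O)) [IsProper q] [SmoothOfRelativeDimension 3 q] (Y : Set P)
    (hYirr : IsIrreducible Y) (hYcl : IsClosed Y) (hPnoeth : IsLocallyNoetherian P) (hPreg : Scheme.IsRegular P)
    (Ch : ∀ X' : Scheme.{0}, (X' ⟶ P) → Set X' → Prop)
    (hChain : ∀ (X' : Scheme.{0}) (σ : X' ⟶ P) (S : Set X'), Ch X' σ S → Chain P Y X' σ S)
    {F₉ : Scheme.{0}} (T₉ Z₉ : Set F₉) (hZ₉ : IsClosed Z₉)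
    (hZdim₉ : ∀ z₉ : ↥(redSub F₉ Z₉ hZ₉), IsClosed ({z₉} : Set ↥(redSub F₉ Z₉ hZ₉)) →
      ringKrullDim ((redSub F₉ Z₉ hZ₉).presheaf.stalk z₉) = ((1 : ℕ) : WithBot ℕ∞)) :
    ∀ (X : Scheme.{0}) (σ : X ⟶ P) (S : Set X) (jG : F₉ ⟶ X) (tG : F₉ ⟶ Spec (.of k)) (𝒞 : X.IdealSheafData),
      Ch X σ S → IsIntegral X → IsLocallyNoetherian X → Scheme.IsRegular X → IsDominant (σ ≫ q) →
      IsPullback jG tG (σ ≫ q) (Spec.map (CommRingCat.ofHom θ)) → jG '' T₉ = S →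
      𝒞.comap jG = vanishingIdeal ⟨Z₉, hZ₉⟩ → Flat (𝒞.subschemeι ≫ σ ≫ q) → Scheme.IsRegular 𝒞.subscheme →
      ∀ x ∈ 𝒞.support, ∃ c : Fin 2 → X.presheaf.stalk x, Ideal.span (Set.range c) = stalkIdeal 𝒞 x ∧ IsQuasiRegular c :=
  hFrame_of_ringKrullDim_redSub O k θ hθ P q Y hYirr hYcl hPnoeth hPreg Ch hChain T₉ Z₉ hZ₉ hZdim₉

/-- **`hZdim₉` in the curve-step binders of the tower** (to be carried by res-D-pv-029's `INV₁` next to `Z₉.Infinite`): on a `Ch`-stage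
`(X, σ, S)` over the smooth proper `P/O` of relative dimension `3` with model square `jG : F₉ ⟶ X`, an `O`-flat centre `𝒞` with exact reduced trace
`𝓘⟨Z₉⟩` and the codimension clause (v) at its closed special points forces `dim 𝒪_{Z̃₉,z} = 1` at every closed point `z` of `Z̃₉`.
[cite: Matsumura1987, Thm. 15.1] [OURS · L1 W4.5b · composition of `ringKrullDim_fibre_stalk_eq_of_codim` with T-DIM]; NOT a statement of
the manuscript. -/
theorem hZdim_curveStep (O : Type) [CommRing O] [IsDomain O] [IsDiscreteValuationRing O] (k : Type) [Field k]
    (θ : O →+* k) (hθ : Function.Surjective θ)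
    (P : Scheme.{0}) [IsIntegral P] (q : P ⟶ Spec (.of O)) [SmoothOfRelativeDimension 3 q] (Y : Set P)
    (hYirr : IsIrreducible Y) (hYcl : IsClosed Y)
    (Ch : ∀ X' : Scheme.{0}, (X' ⟶ P) → Set X' → Prop)
    (hChain : ∀ (X' : Scheme.{0}) (σ : X' ⟶ P) (S : Set X'), Ch X' σ S → Chain P Y X' σ S)
    {X : Scheme.{0}} {σ : X ⟶ P} {S : Set X} (hCh : Ch X σ S) [IsLocallyNoetherian X]
    {F₉ : Scheme.{0}} {jG : F₉ ⟶ X} {tG : F₉ ⟶ Spec (.of k)} (hsq : IsPullback jG tG (σ ≫ q) (Spec.map (CommRingCat.ofHom θ)))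
    (𝒞 : X.IdealSheafData) [Flat (𝒞.subschemeι ≫ σ ≫ q)] {Z₉ : Set F₉} {hZ₉ : IsClosed Z₉}
    (hCD : 𝒞.comap jG = vanishingIdeal ⟨Z₉, hZ₉⟩)
    (hv : ∀ x ∈ 𝒞.support, (σ ≫ q) x = closedPoint O → IsClosed ({x} : Set X) →
      ringKrullDim (X.presheaf.stalk x ⧸ stalkIdeal 𝒞 x) + 2 = ringKrullDim (X.presheaf.stalk x)) :
    ∀ z₉ : ↥(redSub F₉ Z₉ hZ₉), IsClosed ({z₉} : Set ↥(redSub F₉ Z₉ hZ₉)) →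
      ringKrullDim ((redSub F₉ Z₉ hZ₉).presheaf.stalk z₉) = ((1 : ℕ) : WithBot ℕ∞) := by
  have hξ : IsGenericPoint hYirr.genericPoint Y := hYirr.isGenericPoint_genericPoint hYcl
  exact ringKrullDim_fibre_stalk_eq_of_codim O k θ hθ (σ ≫ q) jG tG hsq 𝒞 hCD (n := 3) (d := 1) rfl
    (fun x _ hxcl hxsp => ringKrullDim_stalk_eq_succ_of_chain q 3 hξ (hChain _ _ _ hCh) hxcl hxsp) hv

end Summit.ResolutionOfSingularities.ResolutionOfSingularities.Cruxes.EquisingularLiftNat.Sections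

end
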